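import Summits.NavierStokesRegularity.FluidComputer.CrayaFrames
import Summits.NavierStokesRegularity.FluidComputer.LatticeSqWeightsRapidDecay

/-!
# Craya coordinates of transversal coefficient families on `ℤ³`: the index set `{k ≠ 0} × Fin 2`,
# synthesis and coordinate maps, Parseval per frequency, weighted summability and rapid decay
(instab3 g5 — implementation 1 of the skew-cut X0 certifier, cell `ns-blowup`, 2026-08-26)

HONEST FRAMING (human ruling D-0035): nothing here is a claim about Navier–Stokes blow-up.
WHAT THIS IS NOT: not NS evidence. MODEL lane bookkeeping, sequel of `CrayaFrames`: the COORDINATES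
in which implementation 1 (INSTAB3-METHOD §2/§4) assembles its Galerkin matrices, i.e. the index
type `ι` on which the abstract X0 chain
(`SkewCutGalerkinFromSections.exists_smooth_eigenvector_Ioo_of_sections'`) is to be instantiated,
and the map from its output (a square-summable scalar family with all polynomial weights) back to
a rapidly decaying transversal VECTOR family `c : ℤ³ → ℂ³` — the input format of the synthesis door
`AbcLinearisedLattice.isLinNSEigenvalue_abcFlow_of_crossForm` (KERNEL-CHAIN.md residue (i)).

* `CrayaIdx = {k : ℤ³ // k ≠ 0} × Fin 2` with its injective lattice label `crayaLab i = (k, a)` (the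
  `lab` of `SkewCutGalerkinLattice.finite_cube_fibre_of_injective` / `exists_neighbour_finsets`);
* `crayaSynth v (k) = ∑_a v(k, a) e_a(k)` (`= 0` at `k = 0`) and `crayaCoord c (k, a) = ⟪e_a(k), c(k)⟫`:
  `crayaSynth v` is transversal and mean-free, `crayaCoord ∘ crayaSynth = id`,
  `crayaSynth ∘ crayaCoord = id` on transversal mean-free families, `‖c(k)‖² = ∑_a |v(k,a)|²`,
  `crayaSynth v = 0 ↔ v = 0`;
* weighted square sums transfer (`summable_weight_norm_sq_crayaSynth`) and
  `rapidDecay_crayaSynth`: `∑_{(k,a)} (1 + ν|k|²)^s |v(k,a)|² < ∞ ∀ s` (the weights `w_i^{2s}`,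
  `w = √(1+|ℓ|)`, `ℓ = −ν|k|²` of the abstract chain) ⇒ `RapidDecay (crayaSynth v)`
  (via `LatticeSqWeightsRapidDecay.rapidDecay_of_summable_sq_weights`).

Mathlib + tree files only. New definitions (review lane): `CrayaIdx`, `crayaLab`, `crayaSynth`,
`crayaCoord`.
-/

noncomputable section

open scoped BigOperators InnerProductSpace ComplexConjugate Matrix
open Finset Matrix

namespace Summit.NavierStokesRegularity.FluidComputer.CrayaFrames

open Literature.Analysis.FluidPDE Literature.Analysis.FluidPDE.SteadyLattice
open Literature.Analysis.FunctionSpaces Literature.Analysis.FunctionSpaces.Torus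

/-! ### §3 Craya coordinates of transversal coefficient families -/

/-- **The Craya index set**: non-zero lattice frequencies times the frame label `a ∈ Fin 2` — the
index type `ι` on which the certifier's (full, class-free) Galerkin matrices live (INSTAB3-METHOD §2:
one complex unknown per `(k, b)`, `k ≠ 0`, `b ∈ {1, 2}`). -/
abbrev CrayaIdx : Type := {k : Fin 3 → ℤ // k ≠ 0} × Fin 2

/-- The lattice label `(k, a)` of a Craya index (the `lab : ι → ℤ³ × Fin 2` of
`SkewCutGalerkinLattice.finite_cube_fibre_of_injective` / `exists_neighbour_finsets`). -/
def crayaLab (i : CrayaIdx) : (Fin 3 → ℤ) × Fin 2 := (i.1.1, i.2)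

/-- The lattice label is injective. -/
theorem crayaLab_injective : Function.Injective crayaLab := by
  rintro ⟨⟨k, hk⟩, a⟩ ⟨⟨k', hk'⟩, a'⟩ h
  simp only [crayaLab, Prod.mk.injEq] at h
  obtain ⟨rfl, rfl⟩ := h
  rfl

/-- **Synthesis**: a scalar family `v` on the Craya index set gives the vector coefficient family
`c(k) = ∑_a v(k, a) e_a(k)` (`c(0) = 0`). -/
def crayaSynth (v : CrayaIdx → ℂ) (k : Fin 3 → ℤ) : EuclideanSpace ℂ (Fin 3) :=
  if h : k = 0 then 0 else ∑ a, v (⟨k, h⟩, a) • crayaVec a k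

/-- **Coordinates**: the Craya coordinates `v(k, a) = ⟪e_a(k), c(k)⟫` of a vector coefficient family. -/
def crayaCoord (c : (Fin 3 → ℤ) → EuclideanSpace ℂ (Fin 3)) (i : CrayaIdx) : ℂ :=
  ⟪crayaVec i.2 i.1.1, c i.1.1⟫_ℂ

/-- The synthesised family is mean-free: `c(0) = 0`. -/
theorem crayaSynth_zero_freq (v : CrayaIdx → ℂ) : crayaSynth v 0 = 0 := by
  simp [crayaSynth]

/-- The synthesis off the zero frequency: `c(k) = ∑_a v(k, a) e_a(k)`. -/
theorem crayaSynth_of_ne_zero (v : CrayaIdx → ℂ) {k : Fin 3 → ℤ} (hk : k ≠ 0) :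
    crayaSynth v k = ∑ a, v (⟨k, hk⟩, a) • crayaVec a k := by
  simp [crayaSynth, hk]

/-- The synthesis at the frequency of an index: `c(k_i) = ∑_a v(k_i, a) e_a(k_i)`. -/
theorem crayaSynth_fst (v : CrayaIdx → ℂ) (i : CrayaIdx) :
    crayaSynth v i.1.1 = ∑ a, v (i.1, a) • crayaVec a i.1.1 :=
  crayaSynth_of_ne_zero v i.1.2

/-- The synthesised family is transversal: `k · c(k) = 0` for every `k`. -/
theorem kdot_crayaSynth (v : CrayaIdx → ℂ) (k : Fin 3 → ℤ) :
    ∑ j, ((k j : ℤ) : ℂ) * crayaSynth v k j = 0 := by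
  by_cases hk : k = 0
  · subst hk; simp
  · rw [crayaSynth_of_ne_zero v hk]; exact kdot_sum_smul_crayaVec k _

/-- `crayaCoord ∘ crayaSynth = id`: `⟪e_a(k), c(k)⟫ = v(k, a)`. -/
theorem crayaCoord_crayaSynth (v : CrayaIdx → ℂ) : crayaCoord (crayaSynth v) = v := by
  funext i
  rw [crayaCoord, crayaSynth_fst, inner_crayaVec_sum_smul i.1.2]

/-- `crayaSynth ∘ crayaCoord = id` on transversal mean-free families. -/
theorem crayaSynth_crayaCoord {c : (Fin 3 → ℤ) → EuclideanSpace ℂ (Fin 3)}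
    (hct : ∀ k : Fin 3 → ℤ, ∑ j, ((k j : ℤ) : ℂ) * c k j = 0) (hc0 : c 0 = 0) :
    crayaSynth (crayaCoord c) = c := by
  funext k
  by_cases hk : k = 0
  · subst hk; rw [crayaSynth_zero_freq, hc0]
  · rw [crayaSynth_of_ne_zero _ hk, eq_sum_inner_crayaVec_of_kdot_eq_zero hk (hct k)]
    rfl

/-- Pointwise Parseval in the frame: `‖c(k)‖² = ∑_a |v(k, a)|²` (`k ≠ 0`). -/
theorem norm_sq_crayaSynth (v : CrayaIdx → ℂ) {k : Fin 3 → ℤ} (hk : k ≠ 0) :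
    ‖crayaSynth v k‖ ^ 2 = ∑ a, ‖v (⟨k, hk⟩, a)‖ ^ 2 := by
  rw [crayaSynth_of_ne_zero v hk, ← inner_self_eq_norm_sq (𝕜 := ℂ), sum_inner]
  simp_rw [inner_smul_left, inner_crayaVec_sum_smul hk]
  rw [map_sum]
  refine Finset.sum_congr rfl fun a _ => ?_
  rw [RCLike.conj_mul, ← RCLike.ofReal_pow, RCLike.ofReal_re]

/-- The synthesis is injective: `c = 0 ↔ v = 0`. -/
theorem crayaSynth_eq_zero_iff (v : CrayaIdx → ℂ) : crayaSynth v = 0 ↔ v = 0 := by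
  constructor
  · intro h
    rw [← crayaCoord_crayaSynth v, h]
    funext i
    simp [crayaCoord]
  · rintro rfl
    funext k
    by_cases hk : k = 0
    · subst hk; exact crayaSynth_zero_freq 0
    · rw [crayaSynth_of_ne_zero _ hk]; simp

/-- A family on `ℤ³` is summable once it is summable over the non-zero frequencies. -/
theorem summable_of_summable_ne_zero {F : (Fin 3 → ℤ) → ℝ}
    (h : Summable fun k' : {k : Fin 3 → ℤ // k ≠ 0} => F k'.1) : Summable F := by
  have hfin : ({k : Fin 3 → ℤ | k ≠ 0}ᶜ : Set (Fin 3 → ℤ)).Finite :=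
    (Set.finite_singleton (0 : Fin 3 → ℤ)).subset fun k hk => by
      simp only [Set.mem_compl_iff, Set.mem_setOf_eq, not_not] at hk
      exact hk
  haveI : Finite ↥({k : Fin 3 → ℤ | k ≠ 0}ᶜ : Set (Fin 3 → ℤ)) := hfin.to_subtype
  exact (summable_subtype_and_compl (s := {k : Fin 3 → ℤ | k ≠ 0})).mp ⟨h, Summable.of_finite⟩

/-- Each frame slice of a summable weighted family on the Craya index set is summable over the
non-zero frequencies. -/
theorem summable_weight_norm_sq_slice (v : CrayaIdx → ℂ) {w : (Fin 3 → ℤ) → ℝ}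
    (h : Summable fun i : CrayaIdx => w i.1.1 * ‖v i‖ ^ 2) (a : Fin 2) :
    Summable fun k' : {k : Fin 3 → ℤ // k ≠ 0} => w k'.1 * ‖v (k', a)‖ ^ 2 := by
  have hinj : Function.Injective fun k' : {k : Fin 3 → ℤ // k ≠ 0} => ((k', a) : CrayaIdx) :=
    fun x y hxy => (Prod.ext_iff.mp hxy).1
  exact h.comp_injective hinj

/-- **Weighted square sums transfer** from Craya coordinates to the vector family: for a weight `w`
on `ℤ³`, `∑_{(k,a)} w(k)|v(k,a)|²` summable ⇒ `∑_k w(k)‖c(k)‖²` summable. -/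
theorem summable_weight_norm_sq_crayaSynth (v : CrayaIdx → ℂ) {w : (Fin 3 → ℤ) → ℝ}
    (h : Summable fun i : CrayaIdx => w i.1.1 * ‖v i‖ ^ 2) :
    Summable fun k => w k * ‖crayaSynth v k‖ ^ 2 := by
  have hsum : Summable fun k' : {k : Fin 3 → ℤ // k ≠ 0} => ∑ a, w k'.1 * ‖v (k', a)‖ ^ 2 :=
    summable_sum (s := (Finset.univ : Finset (Fin 2))) fun a _ => summable_weight_norm_sq_slice v h a
  have hsub : Summable fun k' : {k : Fin 3 → ℤ // k ≠ 0} => w k'.1 * ‖crayaSynth v k'.1‖ ^ 2 := by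
    refine hsum.congr fun k' => ?_
    rw [norm_sq_crayaSynth v k'.2, Finset.mul_sum]
  exact summable_of_summable_ne_zero hsub

/-- **All-weights summability of the Craya coordinates gives a rapidly decaying vector family.**
If `∑_{(k,a)} (1 + ν|k|²)^s |v(k,a)|² < ∞` for every `s` (`ν > 0`; these are the weights
`w_i^{2s}`, `w = √(1 + |ℓ|)`, `ℓ = −ν|k|²`, of the abstract X0 chain), then `RapidDecay (crayaSynth v)`. -/
theorem rapidDecay_crayaSynth (v : CrayaIdx → ℂ) {ν : ℝ} (hν : 0 < ν)
    (h : ∀ s : ℕ, Summable fun i : CrayaIdx => (1 + ν * freqNormSq i.1.1) ^ s * ‖v i‖ ^ 2) :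
    RapidDecay (crayaSynth v) := by
  refine LatticeSqWeightsRapidDecay.rapidDecay_of_summable_sq_weights fun s => ?_
  -- `(1 + x)^s ≤ C^s (1 + ν x)^s` with `C = max 1 ν⁻¹`
  have hC1 : (1 : ℝ) ≤ max 1 ν⁻¹ := le_max_left _ _
  have hCν : (1 : ℝ) ≤ max 1 ν⁻¹ * ν :=
    calc (1 : ℝ) = ν⁻¹ * ν := (inv_mul_cancel₀ hν.ne').symm
      _ ≤ max 1 ν⁻¹ * ν := mul_le_mul_of_nonneg_right (le_max_right _ _) hν.le
  have hcmp : ∀ k : Fin 3 → ℤ,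
      (1 + freqNormSq k) ^ s ≤ (max 1 ν⁻¹) ^ s * (1 + ν * freqNormSq k) ^ s := by
    intro k
    have hx : 0 ≤ freqNormSq k := freqNormSq_nonneg k
    have hle : 1 + freqNormSq k ≤ max 1 ν⁻¹ * (1 + ν * freqNormSq k) := by
      have h1 : 0 ≤ (max 1 ν⁻¹ - 1) + (max 1 ν⁻¹ * ν - 1) * freqNormSq k :=
        add_nonneg (sub_nonneg.2 hC1) (mul_nonneg (sub_nonneg.2 hCν) hx)
      linarith
    rw [← mul_pow]
    exact pow_le_pow_left₀ (by linarith) hle s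
  have hs := (summable_weight_norm_sq_crayaSynth v (w := fun k => (1 + ν * freqNormSq k) ^ s)
    (h s)).mul_left ((max 1 ν⁻¹) ^ s)
  refine Summable.of_nonneg_of_le (fun k => ?_) (fun k => ?_) hs
  · exact mul_nonneg (pow_nonneg (by linarith [freqNormSq_nonneg k]) _) (sq_nonneg _)
  · rw [← mul_assoc]
    exact mul_le_mul_of_nonneg_right (hcmp k) (sq_nonneg _)

end Summit.NavierStokesRegularity.FluidComputer.CrayaFrames

end
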